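import Literature.Geometry.Kaehler.SiegelTorusThetaGradientModular
import Literature.Geometry.Kaehler.ComplexTorusDivisorBorderedHessianRank
import HarnessLib

/-!
# De Jong's `η = det B_ϑ` on the theta divisor under `Sp_{2g}(ℤ)`: the gradient transforms by `ᵗ(γZ+δ)`,
# `η(ᵗ(γZ+δ)⁻¹v, M(Z)) = det(γZ+δ)² · C^{n+1} · q(v)^{n+1} · η(v, Z)` on `ϑ = 0`, and the rank of the
# bordered Hessian — the ramification loci of the Gauss map — is a modular invariant

[tag: lange-cav-complex-tori] [linked: HodgeConjecture (lit-hodgefound SKELETON §A2, row A2-210)]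

Layer `Literature/Geometry/Kaehler`, namespaces `Literature.Geometry.Kaehler.SCV` (§1–§2) and
`Literature.Geometry.Kaehler.ComplexTorus` (§3); lane `lit-hodgefound` (Track 2 foundations library),
skeleton seat `lit-hodgefound-skel-2` (generation 43), plan row A2-210 = pointer (70) of the gen-42 final
list ("the modular weight `(n+5)/2` of `η` under `Sp(2g,ℤ)` — de Jong Thm. 1.3, modular half — on top of
the tree's Siegel theta transformation files"). The LATTICE half of de Jong's Theorem 1.3 ("`η` is a
theta function of order `n + 1` on `Θ`") is A2-200 `ComplexTorusDivisorBorderedHessian`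
(`det_borderedHessian_add_latticeVec`, via de Jong's substitution `det_bordered_transform`); the rank
`rk B = rk S_x + 2` and its `Λ`-invariance are A2-207. Here the MODULAR half, for every characteristic
and every `M ∈ Sp_{2g}(ℤ)`, up to the constant `C = C(Z, M, c)` of the tree's transformation formula
`exists_riemannThetaChar_transform` (`ϑ[M[c]](ᵗD⁻¹v, M(Z)) = C · e(πi ᵗv D⁻¹γ v) · ϑ[c](v, Z)`,
`D = γZ + δ`; the identification `C = ζ_γ det(D)^{1/2}` is not used): on `ϑ[c](v, Z) = 0` the gradient
transforms by `ᵗD` and the factor `C q(v)`, the bordered-Hessian determinant `η` by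
`det(D)² · (C q(v))^{n+1}` — de Jong's `det(cτ+d)^{(n+5)/2} ζ^{n+1} q^{n+1}` once `C² ∼ det D` — and
the RANK of the bordered Hessian (A2-207: `rk S_x + 2`, the Thom–Boardman type of the Gauss map at `x`)
is invariant. Theorems only; no definition, no named fact.

Sources, VERBATIM. R. de Jong, *Theta functions on the theta divisor*, Rocky Mountain J. Math. 40
(2010) [held `paper:arxiv-math_0611810`], §1 (chunk p0003): "Under this action, the Riemann theta
function transforms as `θ(ᵗ(cτ+d)⁻¹z, (aτ+b)(cτ+d)⁻¹) = ζ_γ det(cτ+d)^{1/2} e^{πi ᵗz(cτ+d)⁻¹cz} θ(z,τ)`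
for some `8`-th root of unity `ζ_γ` […] **Definition 1.1.** […] `η = η(z,τ) = ᵗ(θ_i)(θ_{ij})^c(θ_j)`.
We want to consider this as a function on the vanishing locus `θ⁻¹(0)` […] **Theorem 1.3.** The
function `η = η(z,τ)` is a theta function of order `n+1` and weight `(n+5)/2` on the theta divisor.
[…] Furthermore, when viewed as a function of two variables `(z,τ)`, the function `η` transforms under
the action of `Γ_{1,2}` with an automorphy factor `det(cτ+d)^{(n+5)/2}` on `θ⁻¹(0)`. It follows that
for any fixed `τ`, the zero locus of `η` is well-defined on `Θ`."; §4, proof (chunk p0008): "We claim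
that `η(ᵗ(cτ+d)⁻¹z, (aτ+b)(cτ+d)⁻¹) = det(cτ+d)^{(n+5)/2} ζ_γ^{n+1} q(z,γ,τ)^{n+1} η(z,τ)` for all
`(z,τ)` satisfying `θ(z,τ) = 0`. This is just a calculation. For `(z,τ)` with `θ(z,τ) = 0` we have
[…] `(θ_i(ᵗ(cτ+d)⁻¹z, (aτ+b)(cτ+d)⁻¹)) = ᵗ(cτ+d) ζ_γ det(cτ+d)^{1/2} q(z,γ,τ) (θ_i(z,τ))`.
Furthermore, for such `(z,τ)` we have `(θ_{ij}(ᵗ(cτ+d)⁻¹z, …)) = ᵗ(cτ+d) ζ_γ det(cτ+d)^{1/2}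
(q θ_{ij} + q_iθ_j + q_jθ_i)(cτ+d)`". S. Grushevsky, R. Salvati Manni, *Jacobians with a vanishing
theta-null in genus 4*, Israel J. Math. 164 (2008) [held `paper:arxiv-math_0605160` p0004]: "Under the
action of `M ∈ Sp(2g,ℤ)` the theta functions transform as follows: `θ[M(ε;δ)](M·τ, ᵗ(cτ+d)⁻¹z) =
φ(ε,δ,M,τ,z) det(cτ+d)^{1/2} θ[ε;δ](τ,z)`". S. Grushevsky, R. Salvati Manni, IMRN 2007 [held
`paper:arxiv-math_0701423` p0007], Remark 4 and Prop. 5: "`det B(τ′,z) = ᵗdF H^c dF(τ′,z)` […] The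
function `η(τ′,z)` vanishes at the point `(τ₀,x₀)` if and only if `x₀` is a ramification point for the
Gauss map `G_{τ₀}` of the theta divisor".

Dictionary. `B_f(x)[e]` = the bordered Hessian matrix `( D²f(x)(eᵢ,eⱼ) df(x)(eᵢ) ; df(x)(eⱼ) 0 )`
of A2-200 in the coordinate basis `eᵢ = Pi.single i 1` of `ℂⁿ` (`η = −det B` up to de Jong's sign,
A2-206); `P ⊕ 1 = Matrix.fromBlocks P 0 0 1`; `F = ϑ[M[c]](·, M(Z))`, `G = ϑ[c](·, Z)`,
`D = denom M Z = γZ + δ`, `q(v) = cexp(πi · v ⬝ᵥ (D⁻¹γ) v)`.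

## Contents

* §1 (linear algebra, any `E`) **`bordered_baseChange`** (`B[b′] = ᵗ(P ⊕ 1) · B[b] · (P ⊕ 1)` for
  `b′ᵢ = Σₗ Pₗᵢ bₗ`), `det_bordered_baseChange` (`det ↦ det(P)² · det`), `rank_bordered_baseChange`
  (rank invariant for invertible `P`).
* §2 (SCV on `ℂⁿ`) `hessianMatrix_eq_of_differentiable` (the tree's two Hessian-matrix conventions
  agree), **`bordered_comp_mulVec`** (`B_{f∘A}(x)[e] = ᵗ(A ⊕ 1) · B_f(Ax)[e] · (A ⊕ 1)` — the chain rule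
  "`(θ_i) ↦ ᵗ(cτ+d)(θ_i)`, `(θ_{ij}) ↦ ᵗ(cτ+d)(θ_{ij})(cτ+d)`"), `det_borderedHessian_comp_mulVec`,
  `rank_borderedHessian_comp_mulVec`; TRANSPORT along an identity `f(Av) = e(v)·g(v)` at a zero of `g`:
  `apply_mulVec_eq_zero_iff_of_comp_mulVec`, **`fderiv_apply_mulVec_eq_of_comp_mulVec`** (`df(Av)(Au) =
  e(v)·dg(v)(u)`), **`det_borderedHessian_mulVec_eq_of_comp_mulVec`** (`det(A)²·det B_f(Av) = e(v)^{n+1}·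
  det B_g(v)` — A2-200 `det_borderedHessian_mul`), **`rank_borderedHessian_mulVec_eq_of_comp_mulVec`**
  (A2-207 `rank_borderedHessian_mul`).
* §3 (theta, `M ∈ Sp_{2g}(ℤ)`, `Z ∈ 𝔥_g`, characteristic `c = (a,b)`, on `ϑ[c](v,Z) = 0`)
  `riemannThetaChar_moeb_mulVec_eq_zero_iff` (the zero sets correspond under `v ↦ ᵗD⁻¹v`),
  **`fderiv_riemannThetaChar_moeb_mulVec_eq_of_eq_zero`** (THE GRADIENT ON `Θ` TRANSFORMS BY `ᵗD` AND
  THE FACTOR `C q(v)`), **`det_borderedHessian_riemannThetaChar_moeb_mulVec_eq_of_eq_zero`** (THE MODULAR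
  HALF OF THM. 1.3: `η_M(ᵗD⁻¹v) = det(D)² (C q(v))^{n+1} η(v)`),
  **`rank_borderedHessian_riemannThetaChar_moeb_mulVec_eq`** (the rank — `rk S_x + 2` — is a modular
  invariant: the ramification and Thom–Boardman loci of the Gauss map on the universal theta divisor
  descend to `𝒜_g`), `det_borderedHessian_riemannThetaChar_moeb_mulVec_eq_zero_iff` ("the zero locus of
  `η` is well-defined": GSM Prop. 5's ramification locus is `Sp_{2g}(ℤ)`-equivariant).

## What is NOT here

The constant `C = ζ_γ det(γZ+δ)^{1/2}` (the tree's `RiemannThetaTransformationKappa` files) and hence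
the literal weight `(n+5)/2`; the line bundle `L = O_Θ(Θ)^{⊗ n+1} ⊗ π^*λ^{⊗2}` on the universal theta
divisor.

## References

* [DeJong2010ThetaFunctionsThetaDivisor] R. de Jong, Rocky Mountain J. Math. 40 (2010), §1 Def. 1.1,
  Thm. 1.3 (chunk p0003), §4 proof (chunk p0008).
* [GrushevskySalvatiManni2008] S. Grushevsky, R. Salvati Manni, Israel J. Math. 164 (2008), Definitions
  5–6 (p0004 of the held text).
* [GrushevskySalvatiManni2007PointsOfOrderTwo] S. Grushevsky, R. Salvati Manni, IMRN 2007, Lemma 2,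
  Remark 4, Prop. 5 (chunk p0007).
* [Lange2023AbelianVarietiesComplex] H. Lange, *Abelian Varieties over the Complex Numbers* (2023),
  §3.3.3 Thm. 3.3.9 (the transformation formula).
* [HormanderSCV1973] L. Hörmander, *An Introduction to Complex Analysis in Several Variables*, Thm.
  2.2.6.
-/

noncomputable section

open scoped Matrix Topology Real
open Set Function Module Complex Matrix
open Literature.Analysis.SpecialFunctions Literature.Analysis.Complex

namespace Literature.Geometry.Kaehler

namespace SCV

/-! ### §1 Change of basis in the bordered matrix: `B[b′] = ᵗ(P ⊕ 1) · B[b] · (P ⊕ 1)` -/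

section BaseChange

variable {E : Type*} [NormedAddCommGroup E] [NormedSpace ℂ E] {ι' : Type*} [Fintype ι'] [DecidableEq ι']

omit [DecidableEq ι'] in
/-- **Change of basis in the bordered matrix**: for a continuous bilinear `T`, a functional `ℓ`, vectors
`b` and a matrix `P`, the bordered matrix in the vectors `b′ᵢ = Σₗ Pₗᵢ bₗ` is `ᵗ(P ⊕ 1) · B[b] · (P ⊕ 1)`
("`(θ_i) ↦ ᵗ(cτ+d)(θ_i)`, `(θ_{ij}) ↦ ᵗ(cτ+d)(θ_{ij})(cτ+d)`"). [cite: DeJong2010ThetaFunctionsThetaDivisor, §4, proof of Thm. 1.3 (chunk p0008)] -/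
theorem bordered_baseChange (T : E →L[ℂ] (E →L[ℂ] ℂ)) (ℓ : E →L[ℂ] ℂ) (b : ι' → E) (P : Matrix ι' ι' ℂ) :
    Matrix.fromBlocks (Matrix.of fun i j => T (∑ l, P l i • b l) (∑ l, P l j • b l))
        (Matrix.of fun i (_ : Unit) => ℓ (∑ l, P l i • b l))
        (Matrix.of fun (_ : Unit) j => ℓ (∑ l, P l j • b l)) (0 : Matrix Unit Unit ℂ) =
      Matrix.fromBlocks Pᵀ 0 0 (1 : Matrix Unit Unit ℂ) *
        Matrix.fromBlocks (Matrix.of fun i j => T (b i) (b j)) (Matrix.of fun i (_ : Unit) => ℓ (b i))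
          (Matrix.of fun (_ : Unit) j => ℓ (b j)) (0 : Matrix Unit Unit ℂ) *
        Matrix.fromBlocks P 0 0 (1 : Matrix Unit Unit ℂ) := by
  have hT : ∀ i j, T (∑ l, P l i • b l) (∑ l, P l j • b l) =
      ∑ l, ∑ k, P l i * P k j * T (b l) (b k) := by
    intro i j
    simp only [map_sum, map_smul, _root_.sum_apply, _root_.smul_apply, smul_eq_mul, Finset.mul_sum]
    rw [Finset.sum_comm]
    refine Finset.sum_congr rfl fun l _ => Finset.sum_congr rfl fun k _ => ?_
    ring
  have hℓ : ∀ i, ℓ (∑ l, P l i • b l) = ∑ l, P l i * ℓ (b l) := by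
    intro i
    simp only [map_sum, map_smul, smul_eq_mul]
  rw [Matrix.fromBlocks_multiply, Matrix.fromBlocks_multiply]
  simp only [Matrix.zero_mul, Matrix.mul_zero, add_zero, zero_add, Matrix.one_mul, Matrix.mul_one]
  ext (i | u) (j | u')
  · simp only [Matrix.fromBlocks_apply₁₁, Matrix.of_apply, hT, Matrix.mul_apply, Matrix.transpose_apply,
      Finset.sum_mul]
    rw [Finset.sum_comm]
    refine Finset.sum_congr rfl fun k _ => Finset.sum_congr rfl fun l _ => ?_
    ring
  · simp only [Matrix.fromBlocks_apply₁₂, Matrix.of_apply, hℓ, Matrix.mul_apply, Matrix.transpose_apply]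
  · simp only [Matrix.fromBlocks_apply₂₁, Matrix.of_apply, hℓ, Matrix.mul_apply]
    exact Finset.sum_congr rfl fun l _ => mul_comm _ _
  · simp only [Matrix.fromBlocks_apply₂₂, Matrix.zero_apply]

/-- `det B[b′] = det(P)² · det B[b]`. [cite: DeJong2010ThetaFunctionsThetaDivisor, §4, proof of Thm. 1.3 (chunk p0008: "`det(cτ+d)^{2+n/2+1/2}`")] -/
theorem det_bordered_baseChange (T : E →L[ℂ] (E →L[ℂ] ℂ)) (ℓ : E →L[ℂ] ℂ) (b : ι' → E)
    (P : Matrix ι' ι' ℂ) :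
    (Matrix.fromBlocks (Matrix.of fun i j => T (∑ l, P l i • b l) (∑ l, P l j • b l))
        (Matrix.of fun i (_ : Unit) => ℓ (∑ l, P l i • b l))
        (Matrix.of fun (_ : Unit) j => ℓ (∑ l, P l j • b l)) (0 : Matrix Unit Unit ℂ)).det =
      P.det ^ 2 * (Matrix.fromBlocks (Matrix.of fun i j => T (b i) (b j))
        (Matrix.of fun i (_ : Unit) => ℓ (b i)) (Matrix.of fun (_ : Unit) j => ℓ (b j))
        (0 : Matrix Unit Unit ℂ)).det := by
  rw [bordered_baseChange, Matrix.det_mul, Matrix.det_mul, Matrix.det_fromBlocks_zero₂₁,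
    Matrix.det_fromBlocks_zero₂₁, Matrix.det_transpose, Matrix.det_one, mul_one]
  ring

/-- `rank B[b′] = rank B[b]` for an invertible `P`. [cite: GrushevskySalvatiManni2008, Definition 6 and the sentence after it (p0004 of the held text)] -/
theorem rank_bordered_baseChange (T : E →L[ℂ] (E →L[ℂ] ℂ)) (ℓ : E →L[ℂ] ℂ) (b : ι' → E)
    {P : Matrix ι' ι' ℂ} (hP : IsUnit P.det) :
    (Matrix.fromBlocks (Matrix.of fun i j => T (∑ l, P l i • b l) (∑ l, P l j • b l))
        (Matrix.of fun i (_ : Unit) => ℓ (∑ l, P l i • b l))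
        (Matrix.of fun (_ : Unit) j => ℓ (∑ l, P l j • b l)) (0 : Matrix Unit Unit ℂ)).rank =
      (Matrix.fromBlocks (Matrix.of fun i j => T (b i) (b j))
        (Matrix.of fun i (_ : Unit) => ℓ (b i)) (Matrix.of fun (_ : Unit) j => ℓ (b j))
        (0 : Matrix Unit Unit ℂ)).rank := by
  have h1 : IsUnit (Matrix.fromBlocks Pᵀ 0 0 (1 : Matrix Unit Unit ℂ)).det := by
    rw [Matrix.det_fromBlocks_zero₂₁, Matrix.det_transpose, Matrix.det_one, mul_one]
    exact hP
  have h2 : IsUnit (Matrix.fromBlocks P 0 0 (1 : Matrix Unit Unit ℂ)).det := by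
    rw [Matrix.det_fromBlocks_zero₂₁, Matrix.det_one, mul_one]
    exact hP
  rw [bordered_baseChange, Matrix.rank_mul_eq_left_of_isUnit_det _ _ h2,
    Matrix.rank_mul_eq_right_of_isUnit_det _ _ h1]

end BaseChange

/-! ### §2 On `ℂⁿ`: the bordered Hessian under a linear substitution, and transport along `f(Av) = e(v)g(v)` -/

section Coordinates

variable {n : ℕ}

/-- Expansion of a vector of `ℂⁿ` in the coordinate vectors `eᵢ = Pi.single i 1`. [folklore] -/
private theorem eq_sum_smul_single₃ (v : Fin n → ℂ) :
    v = ∑ l, v l • (Pi.single l (1 : ℂ) : Fin n → ℂ) := by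
  funext i
  simp [Finset.sum_apply, Pi.single_apply]

/-- The `i`-th column: `A eᵢ = Σₗ Aₗᵢ eₗ`. [folklore] -/
private theorem mulVec_single_one_eq_sum (A : Matrix (Fin n) (Fin n) ℂ) (i : Fin n) :
    A *ᵥ Pi.single i (1 : ℂ) = ∑ l, A l i • (Pi.single l (1 : ℂ) : Fin n → ℂ) := by
  rw [Matrix.mulVec_single_one]
  exact eq_sum_smul_single₃ (A.col i)

/-- The two Hessian-matrix conventions of the tree agree for an entire `f`: the matrix of iterated
partials `(∂ⱼ(∂ᵢf))(x)` (`MemThetaNullRank`, `SiegelTorusThetaNullRankModular`) is the matrix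
`(D²f(x)(eᵢ, eⱼ))` of A2-200 (symmetry of `D²f`). [cite: HormanderSCV1973, Thm 2.2.6] -/
theorem hessianMatrix_eq_of_differentiable {f : (Fin n → ℂ) → ℂ} (hf : Differentiable ℂ f)
    (x : Fin n → ℂ) :
    (Matrix.of fun i j : Fin n => fderiv ℂ (fun z => fderiv ℂ f z (Pi.single i (1 : ℂ))) x
        (Pi.single j (1 : ℂ))) =
      Matrix.of fun i j : Fin n => fderiv ℂ (fderiv ℂ f) x (Pi.single i (1 : ℂ)) (Pi.single j (1 : ℂ)) := by
  ext i j
  rw [Matrix.of_apply, Matrix.of_apply, ComplexTorus.fderiv_fderiv_apply_eq_of_differentiable hf,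
    fderiv_fderiv_symm hf]

/-- **The bordered Hessian under a linear substitution**: for an entire `f` on `ℂⁿ` and a matrix `A`,
`B_{f∘A}(x)[e] = ᵗ(A ⊕ 1) · B_f(Ax)[e] · (A ⊕ 1)` — "`(θ_i(ᵗ(cτ+d)⁻¹z, …)) = ᵗ(cτ+d) … (θ_i(z,τ))`,
`(θ_{ij}(…)) = ᵗ(cτ+d) … (cτ+d)`". [cite: DeJong2010ThetaFunctionsThetaDivisor, §4, proof of Thm. 1.3 (chunk p0008)] [cite: HormanderSCV1973, Thm 2.2.6] -/
theorem bordered_comp_mulVec {f : (Fin n → ℂ) → ℂ} (hf : Differentiable ℂ f)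
    (A : Matrix (Fin n) (Fin n) ℂ) (x : Fin n → ℂ) :
    Matrix.fromBlocks
        (Matrix.of fun i j : Fin n => fderiv ℂ (fderiv ℂ (fun z => f (A *ᵥ z))) x (Pi.single i (1 : ℂ))
          (Pi.single j (1 : ℂ)))
        (Matrix.of fun (i : Fin n) (_ : Unit) => fderiv ℂ (fun z => f (A *ᵥ z)) x (Pi.single i (1 : ℂ)))
        (Matrix.of fun (_ : Unit) (j : Fin n) => fderiv ℂ (fun z => f (A *ᵥ z)) x (Pi.single j (1 : ℂ)))
        (0 : Matrix Unit Unit ℂ) =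
      Matrix.fromBlocks Aᵀ 0 0 (1 : Matrix Unit Unit ℂ) *
        Matrix.fromBlocks
          (Matrix.of fun i j : Fin n => fderiv ℂ (fderiv ℂ f) (A *ᵥ x) (Pi.single i (1 : ℂ))
            (Pi.single j (1 : ℂ)))
          (Matrix.of fun (i : Fin n) (_ : Unit) => fderiv ℂ f (A *ᵥ x) (Pi.single i (1 : ℂ)))
          (Matrix.of fun (_ : Unit) (j : Fin n) => fderiv ℂ f (A *ᵥ x) (Pi.single j (1 : ℂ)))
          (0 : Matrix Unit Unit ℂ) *
        Matrix.fromBlocks A 0 0 (1 : Matrix Unit Unit ℂ) := by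
  have h2 : ∀ i j : Fin n, fderiv ℂ (fderiv ℂ (fun z => f (A *ᵥ z))) x (Pi.single i (1 : ℂ))
      (Pi.single j (1 : ℂ)) = fderiv ℂ (fderiv ℂ f) (A *ᵥ x) (∑ l, A l i • (Pi.single l (1 : ℂ) : Fin n → ℂ))
        (∑ l, A l j • (Pi.single l (1 : ℂ) : Fin n → ℂ)) := by
    intro i j
    rw [ComplexTorus.fderiv_fderiv_comp_mulVec hf, mulVec_single_one_eq_sum, mulVec_single_one_eq_sum]
  have h1 : ∀ i : Fin n, fderiv ℂ (fun z => f (A *ᵥ z)) x (Pi.single i (1 : ℂ)) =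
      fderiv ℂ f (A *ᵥ x) (∑ l, A l i • (Pi.single l (1 : ℂ) : Fin n → ℂ)) := by
    intro i
    rw [ComplexTorus.fderiv_comp_mulVec_apply hf, mulVec_single_one_eq_sum]
  simp only [h1, h2]
  exact bordered_baseChange (fderiv ℂ (fderiv ℂ f) (A *ᵥ x)) (fderiv ℂ f (A *ᵥ x))
    (fun l => (Pi.single l (1 : ℂ) : Fin n → ℂ)) A

/-- `det B_{f∘A}(x)[e] = det(A)² · det B_f(Ax)[e]`. [cite: DeJong2010ThetaFunctionsThetaDivisor, §4, proof of Thm. 1.3 (chunk p0008)] -/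
theorem det_borderedHessian_comp_mulVec {f : (Fin n → ℂ) → ℂ} (hf : Differentiable ℂ f)
    (A : Matrix (Fin n) (Fin n) ℂ) (x : Fin n → ℂ) :
    (Matrix.fromBlocks
        (Matrix.of fun i j : Fin n => fderiv ℂ (fderiv ℂ (fun z => f (A *ᵥ z))) x (Pi.single i (1 : ℂ))
          (Pi.single j (1 : ℂ)))
        (Matrix.of fun (i : Fin n) (_ : Unit) => fderiv ℂ (fun z => f (A *ᵥ z)) x (Pi.single i (1 : ℂ)))
        (Matrix.of fun (_ : Unit) (j : Fin n) => fderiv ℂ (fun z => f (A *ᵥ z)) x (Pi.single j (1 : ℂ)))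
        (0 : Matrix Unit Unit ℂ)).det =
      A.det ^ 2 * (Matrix.fromBlocks
          (Matrix.of fun i j : Fin n => fderiv ℂ (fderiv ℂ f) (A *ᵥ x) (Pi.single i (1 : ℂ))
            (Pi.single j (1 : ℂ)))
          (Matrix.of fun (i : Fin n) (_ : Unit) => fderiv ℂ f (A *ᵥ x) (Pi.single i (1 : ℂ)))
          (Matrix.of fun (_ : Unit) (j : Fin n) => fderiv ℂ f (A *ᵥ x) (Pi.single j (1 : ℂ)))
          (0 : Matrix Unit Unit ℂ)).det := by
  rw [bordered_comp_mulVec hf A x, Matrix.det_mul, Matrix.det_mul, Matrix.det_fromBlocks_zero₂₁,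
    Matrix.det_fromBlocks_zero₂₁, Matrix.det_transpose, Matrix.det_one, mul_one]
  ring

/-- `rank B_{f∘A}(x)[e] = rank B_f(Ax)[e]` for an invertible `A`. [cite: GrushevskySalvatiManni2008, Definition 6 and the sentence after it (p0004 of the held text)] -/
theorem rank_borderedHessian_comp_mulVec {f : (Fin n → ℂ) → ℂ} (hf : Differentiable ℂ f)
    {A : Matrix (Fin n) (Fin n) ℂ} (hA : IsUnit A.det) (x : Fin n → ℂ) :
    (Matrix.fromBlocks
        (Matrix.of fun i j : Fin n => fderiv ℂ (fderiv ℂ (fun z => f (A *ᵥ z))) x (Pi.single i (1 : ℂ))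
          (Pi.single j (1 : ℂ)))
        (Matrix.of fun (i : Fin n) (_ : Unit) => fderiv ℂ (fun z => f (A *ᵥ z)) x (Pi.single i (1 : ℂ)))
        (Matrix.of fun (_ : Unit) (j : Fin n) => fderiv ℂ (fun z => f (A *ᵥ z)) x (Pi.single j (1 : ℂ)))
        (0 : Matrix Unit Unit ℂ)).rank =
      (Matrix.fromBlocks
          (Matrix.of fun i j : Fin n => fderiv ℂ (fderiv ℂ f) (A *ᵥ x) (Pi.single i (1 : ℂ))
            (Pi.single j (1 : ℂ)))
          (Matrix.of fun (i : Fin n) (_ : Unit) => fderiv ℂ f (A *ᵥ x) (Pi.single i (1 : ℂ)))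
          (Matrix.of fun (_ : Unit) (j : Fin n) => fderiv ℂ f (A *ᵥ x) (Pi.single j (1 : ℂ)))
          (0 : Matrix Unit Unit ℂ)).rank := by
  have h1 : IsUnit (Matrix.fromBlocks Aᵀ 0 0 (1 : Matrix Unit Unit ℂ)).det := by
    rw [Matrix.det_fromBlocks_zero₂₁, Matrix.det_transpose, Matrix.det_one, mul_one]
    exact hA
  have h2 : IsUnit (Matrix.fromBlocks A 0 0 (1 : Matrix Unit Unit ℂ)).det := by
    rw [Matrix.det_fromBlocks_zero₂₁, Matrix.det_one, mul_one]
    exact hA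
  rw [bordered_comp_mulVec hf A x, Matrix.rank_mul_eq_left_of_isUnit_det _ _ h2,
    Matrix.rank_mul_eq_right_of_isUnit_det _ _ h1]

/-- Transport of zero sets along `f(Av) = e(v)·g(v)` with `e(v) ≠ 0`. [cite: DeJong2010ThetaFunctionsThetaDivisor, §4, proof of Thm. 1.3 (chunk p0008)] -/
theorem apply_mulVec_eq_zero_iff_of_comp_mulVec {f g e : (Fin n → ℂ) → ℂ} {A : Matrix (Fin n) (Fin n) ℂ}
    (h : ∀ v, f (A *ᵥ v) = e v * g v) {v : Fin n → ℂ} (hev : e v ≠ 0) :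
    f (A *ᵥ v) = 0 ↔ g v = 0 := by
  rw [h v, mul_eq_zero, or_iff_right hev]

/-- **Transport of the gradient**: if `f(Av) = e(v)·g(v)` for all `v` and `g(v) = 0`, then
`df(Av)(Au) = e(v)·dg(v)(u)` ("`(θ_i(ᵗ(cτ+d)⁻¹z, …)) = ᵗ(cτ+d) ζ_γ det(cτ+d)^{1/2} q (θ_i(z,τ))`" on
`θ = 0`). [cite: DeJong2010ThetaFunctionsThetaDivisor, §4, proof of Thm. 1.3 (chunk p0008)] -/
theorem fderiv_apply_mulVec_eq_of_comp_mulVec {f g e : (Fin n → ℂ) → ℂ} (hf : Differentiable ℂ f)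
    (hg : Differentiable ℂ g) (he : Differentiable ℂ e) (A : Matrix (Fin n) (Fin n) ℂ)
    (h : ∀ v, f (A *ᵥ v) = e v * g v) {v : Fin n → ℂ} (hgv : g v = 0) (u : Fin n → ℂ) :
    fderiv ℂ f (A *ᵥ v) (A *ᵥ u) = e v * fderiv ℂ g v u := by
  have hfun : (fun z => f (A *ᵥ z)) = e * g := funext fun z => by rw [h z, Pi.mul_apply]
  rw [← ComplexTorus.fderiv_comp_mulVec_apply hf A v u, hfun]
  have hmul : fderiv ℂ (e * g) v = e v • fderiv ℂ g v + g v • fderiv ℂ e v := fderiv_mul (he v) (hg v)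
  rw [hmul, _root_.add_apply, _root_.smul_apply, _root_.smul_apply, hgv, smul_eq_mul, smul_eq_mul,
    zero_mul, add_zero]

/-- **Transport of `η`**: if `f(Av) = e(v)·g(v)` for all `v` and `g(v) = 0`, then
`det(A)² · det B_f(Av)[e] = e(v)^{n+1} · det B_g(v)[e]` (the substitution rule for `B`, then de Jong's
substitution `(θ_{ij}) ↦ qθ_{ij} + q_iθ_j + q_jθ_i`, `(θ_i) ↦ qθ_i` of A2-200 `det_borderedHessian_mul`).
[cite: DeJong2010ThetaFunctionsThetaDivisor, §4, proof of Thm. 1.3 (chunk p0008: "which, in turn, is equal to `det(cτ+d)^{(n+5)/2} ζ_γ^{n+1} q^{n+1} η(z,τ)`")] -/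
theorem det_borderedHessian_mulVec_eq_of_comp_mulVec {f g e : (Fin n → ℂ) → ℂ}
    (hf : Differentiable ℂ f) (hg : Differentiable ℂ g) (he : Differentiable ℂ e)
    (A : Matrix (Fin n) (Fin n) ℂ) (h : ∀ v, f (A *ᵥ v) = e v * g v) {v : Fin n → ℂ} (hgv : g v = 0) :
    A.det ^ 2 * (Matrix.fromBlocks
          (Matrix.of fun i j : Fin n => fderiv ℂ (fderiv ℂ f) (A *ᵥ v) (Pi.single i (1 : ℂ))
            (Pi.single j (1 : ℂ)))
          (Matrix.of fun (i : Fin n) (_ : Unit) => fderiv ℂ f (A *ᵥ v) (Pi.single i (1 : ℂ)))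
          (Matrix.of fun (_ : Unit) (j : Fin n) => fderiv ℂ f (A *ᵥ v) (Pi.single j (1 : ℂ)))
          (0 : Matrix Unit Unit ℂ)).det =
      e v ^ (n + 1) * (Matrix.fromBlocks
          (Matrix.of fun i j : Fin n => fderiv ℂ (fderiv ℂ g) v (Pi.single i (1 : ℂ)) (Pi.single j (1 : ℂ)))
          (Matrix.of fun (i : Fin n) (_ : Unit) => fderiv ℂ g v (Pi.single i (1 : ℂ)))
          (Matrix.of fun (_ : Unit) (j : Fin n) => fderiv ℂ g v (Pi.single j (1 : ℂ)))
          (0 : Matrix Unit Unit ℂ)).det := by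
  have hfun : (fun z => f (A *ᵥ z)) = e * g := funext fun z => by rw [h z, Pi.mul_apply]
  rw [← det_borderedHessian_comp_mulVec hf A v, hfun,
    det_borderedHessian_mul hg he hgv (fun i : Fin n => (Pi.single i (1 : ℂ) : Fin n → ℂ)),
    Fintype.card_fin]

/-- **Transport of the rank**: if `f(Av) = e(v)·g(v)` for all `v`, `A` is invertible, `g(v) = 0` and
`e(v) ≠ 0`, then `rank B_f(Av)[e] = rank B_g(v)[e]` (A2-207 `rank_borderedHessian_mul`: de Jong's
substitution is a congruence). [cite: GrushevskySalvatiManni2008, Definition 6 and the sentence after it (p0004 of the held text)] [cite: DeJong2010ThetaFunctionsThetaDivisor, §4, proof of Thm. 1.3 (chunk p0008)] -/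
theorem rank_borderedHessian_mulVec_eq_of_comp_mulVec [NeZero n] {f g e : (Fin n → ℂ) → ℂ}
    (hf : Differentiable ℂ f) (hg : Differentiable ℂ g) (he : Differentiable ℂ e)
    {A : Matrix (Fin n) (Fin n) ℂ} (hA : IsUnit A.det) (h : ∀ v, f (A *ᵥ v) = e v * g v)
    {v : Fin n → ℂ} (hgv : g v = 0) (hev : e v ≠ 0) :
    (Matrix.fromBlocks
          (Matrix.of fun i j : Fin n => fderiv ℂ (fderiv ℂ f) (A *ᵥ v) (Pi.single i (1 : ℂ))
            (Pi.single j (1 : ℂ)))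
          (Matrix.of fun (i : Fin n) (_ : Unit) => fderiv ℂ f (A *ᵥ v) (Pi.single i (1 : ℂ)))
          (Matrix.of fun (_ : Unit) (j : Fin n) => fderiv ℂ f (A *ᵥ v) (Pi.single j (1 : ℂ)))
          (0 : Matrix Unit Unit ℂ)).rank =
      (Matrix.fromBlocks
          (Matrix.of fun i j : Fin n => fderiv ℂ (fderiv ℂ g) v (Pi.single i (1 : ℂ)) (Pi.single j (1 : ℂ)))
          (Matrix.of fun (i : Fin n) (_ : Unit) => fderiv ℂ g v (Pi.single i (1 : ℂ)))
          (Matrix.of fun (_ : Unit) (j : Fin n) => fderiv ℂ g v (Pi.single j (1 : ℂ)))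
          (0 : Matrix Unit Unit ℂ)).rank := by
  have hfun : (fun z => f (A *ᵥ z)) = e * g := funext fun z => by rw [h z, Pi.mul_apply]
  rw [← rank_borderedHessian_comp_mulVec hf hA v, hfun]
  exact rank_borderedHessian_mul hg he hgv hev _

end Coordinates

end SCV

/-! ### §3 Theta functions: de Jong's `η` and the rank of `B_ϑ` under `Sp_{2g}(ℤ)` -/

namespace ComplexTorus

open Literature.NumberTheory.Automorphic (siegelUpperHalfSpace)
open Literature.NumberTheory.ModularForms.SiegelUpperHalfSpace (moeb denom)

section ThetaModular

variable {n : ℕ} {M : Matrix (Fin n ⊕ Fin n) (Fin n ⊕ Fin n) ℤ} {Z : Matrix (Fin n) (Fin n) ℂ}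

/-- The quadratic form `v ↦ ᵗv S v` is differentiable. [folklore] -/
private theorem differentiable_dotProduct_mulVec_self₃ (S : Matrix (Fin n) (Fin n) ℂ) :
    Differentiable ℂ fun v : Fin n → ℂ => v ⬝ᵥ (S *ᵥ v) := by
  simp only [dotProduct, mulVec]
  fun_prop

/-- `v ↦ C · e(c ᵗv S v)` is entire. [folklore] -/
private theorem differentiable_const_mul_cexp_dotProduct_mulVec₃ (C c : ℂ)
    (S : Matrix (Fin n) (Fin n) ℂ) :
    Differentiable ℂ fun v : Fin n → ℂ => C * cexp (c * (v ⬝ᵥ (S *ᵥ v))) :=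
  (((differentiable_dotProduct_mulVec_self₃ S).const_mul c).cexp).const_mul C

/-- `ϑ[M[c]](·, M(Z))` is entire. [cite: Lange2023AbelianVarietiesComplex, §3.3.3 Thm. 3.3.9] -/
private theorem differentiable_riemannThetaChar_moeb₃ (hM : M ∈ Matrix.symplecticGroup (Fin n) ℤ)
    (hZ : Z ∈ siegelUpperHalfSpace n) (a b : Fin n → ℂ) :
    Differentiable ℂ (riemannThetaChar (thetaCharFst M a b) (thetaCharSnd M a b)
      (moeb (M.map ((↑) : ℤ → ℂ)) Z)) := by
  have hZ' := moeb_intCast_mem hM hZ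
  obtain ⟨c', hc', hY'⟩ := exists_pos_mul_sum_sq_le_of_posDef_im _ hZ'.2
  exact differentiable_riemannThetaChar _ (fun i j => (hZ'.1.apply i j).symm) hc' hY' _ _

/-- `ϑ[c](·, Z)` is entire. [cite: Lange2023AbelianVarietiesComplex, §3.3.3 Thm. 3.3.9] -/
private theorem differentiable_riemannThetaChar₃ (hZ : Z ∈ siegelUpperHalfSpace n) (a b : Fin n → ℂ) :
    Differentiable ℂ (riemannThetaChar a b Z) := by
  obtain ⟨c, hc, hY⟩ := exists_pos_mul_sum_sq_le_of_posDef_im Z hZ.2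
  exact differentiable_riemannThetaChar Z (fun i j => (hZ.1.apply i j).symm) hc hY a b

/-- **The zero sets correspond**: `ϑ[M[c]](ᵗD⁻¹v, M(Z)) = 0 ⟺ ϑ[c](v, Z) = 0` (`D = γZ + δ`; the factor
`C e(πi ᵗvD⁻¹γv)` is a unit). [cite: DeJong2010ThetaFunctionsThetaDivisor, §4, proof of Thm. 1.3 (chunk p0008: "for all `(z,τ)` satisfying `θ(z,τ) = 0`")] [cite: GrushevskySalvatiManni2008, Definition 5 (p0004 of the held text)] -/
theorem riemannThetaChar_moeb_mulVec_eq_zero_iff (hM : M ∈ Matrix.symplecticGroup (Fin n) ℤ)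
    (hZ : Z ∈ siegelUpperHalfSpace n) (a b v : Fin n → ℂ) :
    riemannThetaChar (thetaCharFst M a b) (thetaCharSnd M a b) (moeb (M.map ((↑) : ℤ → ℂ)) Z)
        ((denom (M.map ((↑) : ℤ → ℂ)) Z)ᵀ⁻¹ *ᵥ v) = 0 ↔
      riemannThetaChar a b Z v = 0 := by
  obtain ⟨C, hC, hCF⟩ := exists_riemannThetaChar_transform hM hZ a b
  rw [hCF v]
  exact ⟨fun h0 => (mul_eq_zero.1 h0).resolve_left (mul_ne_zero hC (Complex.exp_ne_zero _)),
    fun h0 => by rw [h0, mul_zero]⟩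

/-- **THE GRADIENT ON THE THETA DIVISOR TRANSFORMS BY `ᵗ(γZ+δ)` AND THE UNIT `C q(v)`**: with the constant
`C ≠ 0` of the transformation formula, for every `v` with `ϑ[c](v, Z) = 0` and every `u`,
`dϑ[M[c]](·, M(Z))(ᵗD⁻¹v)(ᵗD⁻¹u) = C · e(πi ᵗvD⁻¹γv) · dϑ[c](·,Z)(v)(u)` — "`(θ_i(ᵗ(cτ+d)⁻¹z,
(aτ+b)(cτ+d)⁻¹)) = ᵗ(cτ+d) ζ_γ det(cτ+d)^{1/2} q(z,γ,τ) (θ_i(z,τ))`" (the Gauss maps of `Θ_Z` and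
`Θ_{M(Z)}` correspond under `ℙ(ᵗD)`). [cite: DeJong2010ThetaFunctionsThetaDivisor, §4, proof of Thm. 1.3 (chunk p0008)] [cite: GrushevskySalvatiManni2008, Definition 5 (p0004 of the held text)] -/
theorem fderiv_riemannThetaChar_moeb_mulVec_eq_of_eq_zero (hM : M ∈ Matrix.symplecticGroup (Fin n) ℤ)
    (hZ : Z ∈ siegelUpperHalfSpace n) (a b : Fin n → ℂ) :
    ∃ C : ℂ, C ≠ 0 ∧ ∀ v : Fin n → ℂ, riemannThetaChar a b Z v = 0 → ∀ u : Fin n → ℂ,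
      fderiv ℂ (riemannThetaChar (thetaCharFst M a b) (thetaCharSnd M a b) (moeb (M.map ((↑) : ℤ → ℂ)) Z))
          ((denom (M.map ((↑) : ℤ → ℂ)) Z)ᵀ⁻¹ *ᵥ v) ((denom (M.map ((↑) : ℤ → ℂ)) Z)ᵀ⁻¹ *ᵥ u) =
        C * cexp (π * I * (v ⬝ᵥ ((denom (M.map ((↑) : ℤ → ℂ)) Z)⁻¹ *
            (M.map ((↑) : ℤ → ℂ)).toBlocks₂₁) *ᵥ v)) * fderiv ℂ (riemannThetaChar a b Z) v u := by
  obtain ⟨C, hC, hCF⟩ := exists_riemannThetaChar_transform hM hZ a b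
  have hFd := differentiable_riemannThetaChar_moeb₃ hM hZ a b
  have hGd := differentiable_riemannThetaChar₃ hZ a b
  have hed := differentiable_const_mul_cexp_dotProduct_mulVec₃ C (π * I)
    ((denom (M.map ((↑) : ℤ → ℂ)) Z)⁻¹ * (M.map ((↑) : ℤ → ℂ)).toBlocks₂₁)
  refine ⟨C, hC, fun v hv u => ?_⟩
  exact SCV.fderiv_apply_mulVec_eq_of_comp_mulVec hFd hGd hed _ hCF hv u

/-- **THE MODULAR HALF OF DE JONG'S THEOREM 1.3 (up to the transformation constant)**: with the constant
`C ≠ 0` of the transformation formula `ϑ[M[c]](ᵗD⁻¹v, M(Z)) = C e(πi ᵗvD⁻¹γv) ϑ[c](v,Z)`, for every `v`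
with `ϑ[c](v, Z) = 0`:
`det B_{ϑ[M[c]](·,M(Z))}(ᵗD⁻¹v)[e] = det(D)² · (C e(πi ᵗvD⁻¹γv))^{n+1} · det B_{ϑ[c](·,Z)}(v)[e]`
— de Jong's "`η(ᵗ(cτ+d)⁻¹z, (aτ+b)(cτ+d)⁻¹) = det(cτ+d)^{(n+5)/2} ζ_γ^{n+1} q(z,γ,τ)^{n+1} η(z,τ)` for
all `(z,τ)` satisfying `θ(z,τ) = 0`" once `C = ζ_γ det(cτ+d)^{1/2}`. [cite: DeJong2010ThetaFunctionsThetaDivisor, Thm. 1.3 (chunk p0003) and §4 proof (chunk p0008)] -/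
theorem det_borderedHessian_riemannThetaChar_moeb_mulVec_eq_of_eq_zero
    (hM : M ∈ Matrix.symplecticGroup (Fin n) ℤ) (hZ : Z ∈ siegelUpperHalfSpace n) (a b : Fin n → ℂ) :
    ∃ C : ℂ, C ≠ 0 ∧ ∀ v : Fin n → ℂ, riemannThetaChar a b Z v = 0 →
      (Matrix.fromBlocks
          (Matrix.of fun i j : Fin n => fderiv ℂ (fderiv ℂ (riemannThetaChar (thetaCharFst M a b)
            (thetaCharSnd M a b) (moeb (M.map ((↑) : ℤ → ℂ)) Z)))
            ((denom (M.map ((↑) : ℤ → ℂ)) Z)ᵀ⁻¹ *ᵥ v) (Pi.single i (1 : ℂ)) (Pi.single j (1 : ℂ)))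
          (Matrix.of fun (i : Fin n) (_ : Unit) => fderiv ℂ (riemannThetaChar (thetaCharFst M a b)
            (thetaCharSnd M a b) (moeb (M.map ((↑) : ℤ → ℂ)) Z))
            ((denom (M.map ((↑) : ℤ → ℂ)) Z)ᵀ⁻¹ *ᵥ v) (Pi.single i (1 : ℂ)))
          (Matrix.of fun (_ : Unit) (j : Fin n) => fderiv ℂ (riemannThetaChar (thetaCharFst M a b)
            (thetaCharSnd M a b) (moeb (M.map ((↑) : ℤ → ℂ)) Z))
            ((denom (M.map ((↑) : ℤ → ℂ)) Z)ᵀ⁻¹ *ᵥ v) (Pi.single j (1 : ℂ)))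
          (0 : Matrix Unit Unit ℂ)).det =
        (denom (M.map ((↑) : ℤ → ℂ)) Z).det ^ 2 *
          (C * cexp (π * I * (v ⬝ᵥ ((denom (M.map ((↑) : ℤ → ℂ)) Z)⁻¹ *
            (M.map ((↑) : ℤ → ℂ)).toBlocks₂₁) *ᵥ v))) ^ (n + 1) *
          (Matrix.fromBlocks
            (Matrix.of fun i j : Fin n => fderiv ℂ (fderiv ℂ (riemannThetaChar a b Z)) v
              (Pi.single i (1 : ℂ)) (Pi.single j (1 : ℂ)))
            (Matrix.of fun (i : Fin n) (_ : Unit) => fderiv ℂ (riemannThetaChar a b Z) v (Pi.single i (1 : ℂ)))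
            (Matrix.of fun (_ : Unit) (j : Fin n) => fderiv ℂ (riemannThetaChar a b Z) v (Pi.single j (1 : ℂ)))
            (0 : Matrix Unit Unit ℂ)).det := by
  obtain ⟨C, hC, hCF⟩ := exists_riemannThetaChar_transform hM hZ a b
  have hFd := differentiable_riemannThetaChar_moeb₃ hM hZ a b
  have hGd := differentiable_riemannThetaChar₃ hZ a b
  have hed := differentiable_const_mul_cexp_dotProduct_mulVec₃ C (π * I)
    ((denom (M.map ((↑) : ℤ → ℂ)) Z)⁻¹ * (M.map ((↑) : ℤ → ℂ)).toBlocks₂₁)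
  have hDu : IsUnit (denom (M.map ((↑) : ℤ → ℂ)) Z).det := isUnit_det_denom_intCast hM hZ
  refine ⟨C, hC, fun v hv => ?_⟩
  have key := SCV.det_borderedHessian_mulVec_eq_of_comp_mulVec hFd hGd hed _ hCF hv
  -- `det(ᵗD⁻¹)² · X = Y` ⟹ `X = det(D)² · Y`
  set X := (Matrix.fromBlocks
          (Matrix.of fun i j : Fin n => fderiv ℂ (fderiv ℂ (riemannThetaChar (thetaCharFst M a b)
            (thetaCharSnd M a b) (moeb (M.map ((↑) : ℤ → ℂ)) Z)))
            ((denom (M.map ((↑) : ℤ → ℂ)) Z)ᵀ⁻¹ *ᵥ v) (Pi.single i (1 : ℂ)) (Pi.single j (1 : ℂ)))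
          (Matrix.of fun (i : Fin n) (_ : Unit) => fderiv ℂ (riemannThetaChar (thetaCharFst M a b)
            (thetaCharSnd M a b) (moeb (M.map ((↑) : ℤ → ℂ)) Z))
            ((denom (M.map ((↑) : ℤ → ℂ)) Z)ᵀ⁻¹ *ᵥ v) (Pi.single i (1 : ℂ)))
          (Matrix.of fun (_ : Unit) (j : Fin n) => fderiv ℂ (riemannThetaChar (thetaCharFst M a b)
            (thetaCharSnd M a b) (moeb (M.map ((↑) : ℤ → ℂ)) Z))
            ((denom (M.map ((↑) : ℤ → ℂ)) Z)ᵀ⁻¹ *ᵥ v) (Pi.single j (1 : ℂ)))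
          (0 : Matrix Unit Unit ℂ)).det with hX
  have hd : ((denom (M.map ((↑) : ℤ → ℂ)) Z)ᵀ⁻¹).det * (denom (M.map ((↑) : ℤ → ℂ)) Z).det = 1 := by
    have h := Matrix.det_nonsing_inv_mul_det _ (Matrix.isUnit_det_transpose _ hDu)
    rwa [Matrix.det_transpose] at h
  calc X = (((denom (M.map ((↑) : ℤ → ℂ)) Z)ᵀ⁻¹).det * (denom (M.map ((↑) : ℤ → ℂ)) Z).det) ^ 2 * X := by
        rw [hd, one_pow, one_mul]
    _ = (denom (M.map ((↑) : ℤ → ℂ)) Z).det ^ 2 * (((denom (M.map ((↑) : ℤ → ℂ)) Z)ᵀ⁻¹).det ^ 2 * X) := by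
        ring
    _ = _ := by rw [key]; ring

/-- **THE RANK OF THE BORDERED HESSIAN ON THE THETA DIVISOR IS A MODULAR INVARIANT** (`g ≥ 1`):
`rank B_{ϑ[M[c]](·,M(Z))}(ᵗD⁻¹v)[e] = rank B_{ϑ[c](·,Z)}(v)[e]` at every `v` with `ϑ[c](v,Z) = 0` — by
A2-207 `rank B = rk S_x + 2` on the smooth part, so the ramification locus of the Gauss map and all its
Thom–Boardman strata on the universal theta divisor are `Sp_{2g}(ℤ)`-equivariant ("the zero locus of `η`
is well-defined"). [cite: DeJong2010ThetaFunctionsThetaDivisor, Thm. 1.3 and sequel (chunk p0003)] [cite: GrushevskySalvatiManni2008, Definition 6 and the sentence after it (p0004 of the held text)] -/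
theorem rank_borderedHessian_riemannThetaChar_moeb_mulVec_eq [NeZero n]
    (hM : M ∈ Matrix.symplecticGroup (Fin n) ℤ) (hZ : Z ∈ siegelUpperHalfSpace n) (a b : Fin n → ℂ)
    {v : Fin n → ℂ} (hv : riemannThetaChar a b Z v = 0) :
    (Matrix.fromBlocks
        (Matrix.of fun i j : Fin n => fderiv ℂ (fderiv ℂ (riemannThetaChar (thetaCharFst M a b)
          (thetaCharSnd M a b) (moeb (M.map ((↑) : ℤ → ℂ)) Z)))
          ((denom (M.map ((↑) : ℤ → ℂ)) Z)ᵀ⁻¹ *ᵥ v) (Pi.single i (1 : ℂ)) (Pi.single j (1 : ℂ)))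
        (Matrix.of fun (i : Fin n) (_ : Unit) => fderiv ℂ (riemannThetaChar (thetaCharFst M a b)
          (thetaCharSnd M a b) (moeb (M.map ((↑) : ℤ → ℂ)) Z))
          ((denom (M.map ((↑) : ℤ → ℂ)) Z)ᵀ⁻¹ *ᵥ v) (Pi.single i (1 : ℂ)))
        (Matrix.of fun (_ : Unit) (j : Fin n) => fderiv ℂ (riemannThetaChar (thetaCharFst M a b)
          (thetaCharSnd M a b) (moeb (M.map ((↑) : ℤ → ℂ)) Z))
          ((denom (M.map ((↑) : ℤ → ℂ)) Z)ᵀ⁻¹ *ᵥ v) (Pi.single j (1 : ℂ)))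
        (0 : Matrix Unit Unit ℂ)).rank =
      (Matrix.fromBlocks
        (Matrix.of fun i j : Fin n => fderiv ℂ (fderiv ℂ (riemannThetaChar a b Z)) v
          (Pi.single i (1 : ℂ)) (Pi.single j (1 : ℂ)))
        (Matrix.of fun (i : Fin n) (_ : Unit) => fderiv ℂ (riemannThetaChar a b Z) v (Pi.single i (1 : ℂ)))
        (Matrix.of fun (_ : Unit) (j : Fin n) => fderiv ℂ (riemannThetaChar a b Z) v (Pi.single j (1 : ℂ)))
        (0 : Matrix Unit Unit ℂ)).rank := by
  obtain ⟨C, hC, hCF⟩ := exists_riemannThetaChar_transform hM hZ a b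
  have hFd := differentiable_riemannThetaChar_moeb₃ hM hZ a b
  have hGd := differentiable_riemannThetaChar₃ hZ a b
  have hed := differentiable_const_mul_cexp_dotProduct_mulVec₃ C (π * I)
    ((denom (M.map ((↑) : ℤ → ℂ)) Z)⁻¹ * (M.map ((↑) : ℤ → ℂ)).toBlocks₂₁)
  have hDu : IsUnit (denom (M.map ((↑) : ℤ → ℂ)) Z).det := isUnit_det_denom_intCast hM hZ
  have hAu : IsUnit ((denom (M.map ((↑) : ℤ → ℂ)) Z)ᵀ⁻¹).det :=
    Matrix.isUnit_nonsing_inv_det_iff.2 (Matrix.isUnit_det_transpose _ hDu)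
  have hev : C * cexp (π * I * (v ⬝ᵥ ((denom (M.map ((↑) : ℤ → ℂ)) Z)⁻¹ *
      (M.map ((↑) : ℤ → ℂ)).toBlocks₂₁) *ᵥ v)) ≠ 0 := mul_ne_zero hC (Complex.exp_ne_zero _)
  exact SCV.rank_borderedHessian_mulVec_eq_of_comp_mulVec hFd hGd hed hAu hCF hv hev

/-- **"The zero locus of `η` is well-defined"** (modular half): at `v` with `ϑ[c](v,Z) = 0`,
`det B_{ϑ[M[c]](·,M(Z))}(ᵗD⁻¹v)[e] = 0 ⟺ det B_{ϑ[c](·,Z)}(v)[e] = 0` — GSM's "ramification point for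
the Gauss map" is an `Sp_{2g}(ℤ)`-equivariant notion. [cite: DeJong2010ThetaFunctionsThetaDivisor, Thm. 1.3, sequel (chunk p0003: "the zero locus of `η` is well-defined on `Θ`")] [cite: GrushevskySalvatiManni2007PointsOfOrderTwo, Prop. 5 (chunk p0007)] -/
theorem det_borderedHessian_riemannThetaChar_moeb_mulVec_eq_zero_iff
    (hM : M ∈ Matrix.symplecticGroup (Fin n) ℤ) (hZ : Z ∈ siegelUpperHalfSpace n) (a b : Fin n → ℂ)
    {v : Fin n → ℂ} (hv : riemannThetaChar a b Z v = 0) :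
    (Matrix.fromBlocks
        (Matrix.of fun i j : Fin n => fderiv ℂ (fderiv ℂ (riemannThetaChar (thetaCharFst M a b)
          (thetaCharSnd M a b) (moeb (M.map ((↑) : ℤ → ℂ)) Z)))
          ((denom (M.map ((↑) : ℤ → ℂ)) Z)ᵀ⁻¹ *ᵥ v) (Pi.single i (1 : ℂ)) (Pi.single j (1 : ℂ)))
        (Matrix.of fun (i : Fin n) (_ : Unit) => fderiv ℂ (riemannThetaChar (thetaCharFst M a b)
          (thetaCharSnd M a b) (moeb (M.map ((↑) : ℤ → ℂ)) Z))
          ((denom (M.map ((↑) : ℤ → ℂ)) Z)ᵀ⁻¹ *ᵥ v) (Pi.single i (1 : ℂ)))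
        (Matrix.of fun (_ : Unit) (j : Fin n) => fderiv ℂ (riemannThetaChar (thetaCharFst M a b)
          (thetaCharSnd M a b) (moeb (M.map ((↑) : ℤ → ℂ)) Z))
          ((denom (M.map ((↑) : ℤ → ℂ)) Z)ᵀ⁻¹ *ᵥ v) (Pi.single j (1 : ℂ)))
        (0 : Matrix Unit Unit ℂ)).det = 0 ↔
      (Matrix.fromBlocks
        (Matrix.of fun i j : Fin n => fderiv ℂ (fderiv ℂ (riemannThetaChar a b Z)) v
          (Pi.single i (1 : ℂ)) (Pi.single j (1 : ℂ)))
        (Matrix.of fun (i : Fin n) (_ : Unit) => fderiv ℂ (riemannThetaChar a b Z) v (Pi.single i (1 : ℂ)))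
        (Matrix.of fun (_ : Unit) (j : Fin n) => fderiv ℂ (riemannThetaChar a b Z) v (Pi.single j (1 : ℂ)))
        (0 : Matrix Unit Unit ℂ)).det = 0 := by
  obtain ⟨C, hC, h⟩ := det_borderedHessian_riemannThetaChar_moeb_mulVec_eq_of_eq_zero hM hZ a b
  have hDu : IsUnit (denom (M.map ((↑) : ℤ → ℂ)) Z).det := isUnit_det_denom_intCast hM hZ
  have hD0 : (denom (M.map ((↑) : ℤ → ℂ)) Z).det ^ 2 ≠ 0 := pow_ne_zero _ hDu.ne_zero
  have hq : (C * cexp (π * I * (v ⬝ᵥ ((denom (M.map ((↑) : ℤ → ℂ)) Z)⁻¹ *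
      (M.map ((↑) : ℤ → ℂ)).toBlocks₂₁) *ᵥ v))) ^ (n + 1) ≠ 0 :=
    pow_ne_zero _ (mul_ne_zero hC (Complex.exp_ne_zero _))
  rw [h v hv, mul_eq_zero, mul_eq_zero, or_iff_right hD0, or_iff_right hq]

end ThetaModular

end ComplexTorus

end Literature.Geometry.Kaehler
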